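import Mathlib.Algebra.Group.Hom.Instances
import Mathlib.Algebra.Group.Equiv.Basic
import Mathlib.Algebra.Group.TypeTags.Hom
import Mathlib.Algebra.Group.Equiv.TypeTags
import Mathlib.Data.NNReal.Defs
import Mathlib.Data.Rat.Cast.CharZero
import Mathlib.Algebra.Order.Archimedean.Basic
import Literature.AlgebraicGeometry.Frobenioids.Monoids
import HarnessLib

/-!
# Frobenioids I, §0: the completion `M ⊗ ℝ_{≥0}` of a monoprime monoid

Mochizuki, *The geometry of Frobenioids I*, Kyushu J. Math. **62** (2008), §0 "Numbers", kurims
p. 10: "If `M` is a `ℚ`-monoprime monoid, then we shall write `M ⊗ ℝ_{≥0}` for the `ℝ`-monoprime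
monoid obtained by completing `M` relative to the topology defined by the ordering on the monoid
`M`."  [cite: MochizukiFrdI2008, §0 p.10]  This object is the input of Def. 2.4 (i)
(`M^rlf_𝔭 := M^pf_𝔭 ⊗ ℝ_{≥0}`, the realification) and hence of every "realified Frobenioid".

**Rendering (canonical, choice-free).** For a commutative monoid `M` put
`M^∨ := Hom(M, ℝ_{≥0})` (monoid homomorphisms into the additive monoid `ℝ_{≥0}`, here
`M →* Multiplicative ℝ≥0`) and define `M ⊗ ℝ_{≥0} := (M^∨)^∨` with the evaluation map
`M → M ⊗ ℝ_{≥0}`.  For a `Λ`-monoprime `M` (`Λ ∈ {ℤ, ℚ, ℝ}`) we PROVE `M^∨ ≅ ℝ_{≥0}` and hence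
`M ⊗ ℝ_{≥0}` is `ℝ`-monoprime (the property printed on p. 10), and that `M → M ⊗ ℝ_{≥0}` is
injective; for `M ≅ ℚ_{≥0}` this is the order completion `ℚ_{≥0} ↪ ℝ_{≥0}` of the text, and the
construction also covers `ℤ`- and `ℝ`-monoprime `M` (Def. 2.4 (i)(c) applies `⊗ ℝ_{≥0}` to the
monoprime monoids `M^pf_𝔭`).  The two facts about additive maps that drive this — an additive map
`ℚ_{≥0} → ℝ_{≥0}` or `ℝ_{≥0} → ℝ_{≥0}` is `x ↦ c · x` — are proved here (the second by the
monotone-density argument).  Multiplicative notation as in `Monoids.lean`.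
-/

noncomputable section

namespace Literature.AlgebraicGeometry.Frobenioids

open Function NNReal

universe u

/-! ### Additive maps out of `ℚ_{≥0}` and `ℝ_{≥0}` into `ℝ_{≥0}` are homotheties -/

section AdditiveMaps

/-- The homothety `q ↦ c · q`, `ℚ_{≥0} → ℝ_{≥0}`. [cite: MochizukiFrdI2008, §0 p.10] -/
def nnratSMulHom (c : ℝ≥0) : ℚ≥0 →+ ℝ≥0 where
  toFun q := c * (q : ℝ≥0)
  map_zero' := by rw [NNRat.cast_zero, mul_zero]
  map_add' p q := by rw [NNRat.cast_add, mul_add]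

/-- An additive map `f : ℚ_{≥0} → ℝ_{≥0}` is `q ↦ f(1) · q`. [cite: MochizukiFrdI2008, §0 p.10] -/
theorem addMonoidHom_nnrat_apply (f : ℚ≥0 →+ ℝ≥0) (q : ℚ≥0) : f q = f 1 * (q : ℝ≥0) := by
  have hden : (q.den : ℝ≥0) ≠ 0 := Nat.cast_ne_zero.mpr q.den_pos.ne'
  have h1 : (q.den : ℝ≥0) * f q = (q.num : ℝ≥0) * f 1 := by
    rw [← nsmul_eq_mul, ← map_nsmul, nsmul_eq_mul, NNRat.den_mul_eq_num,
      show (q.num : ℚ≥0) = q.num • (1 : ℚ≥0) by rw [nsmul_eq_mul, mul_one], map_nsmul, nsmul_eq_mul]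
  have h2 : (q : ℝ≥0) = (q.num : ℝ≥0) / (q.den : ℝ≥0) := by
    rw [← NNRat.cast_natCast q.num, ← NNRat.cast_natCast q.den, ← NNRat.cast_div, NNRat.num_div_den]
  rw [h2, mul_div, eq_div_iff hden, mul_comm (f q), h1, mul_comm]

/-- `Hom(ℚ_{≥0}, ℝ_{≥0}) ≅ ℝ_{≥0}` via `f ↦ f(1)`. [cite: MochizukiFrdI2008, §0 p.10] -/
def nnratAddHomEquiv : (ℚ≥0 →+ ℝ≥0) ≃+ ℝ≥0 where
  toFun f := f 1
  invFun c := nnratSMulHom c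
  left_inv f := AddMonoidHom.ext fun q => (addMonoidHom_nnrat_apply f q).symm
  right_inv c := by
    change c * ((1 : ℚ≥0) : ℝ≥0) = c
    rw [NNRat.cast_one, mul_one]
  map_add' _ _ := rfl

/-- An additive map `ℝ_{≥0} → ℝ_{≥0}` is monotone (`b = a + c ⇒ f b = f a + f c ≥ f a`). [folklore] -/
private theorem addMonoidHom_nnreal_monotone (f : ℝ≥0 →+ ℝ≥0) : Monotone f := by
  intro a b hab
  obtain ⟨c, rfl⟩ := exists_add_of_le hab
  rw [map_add]
  exact le_self_add

/-- An additive map `ℝ_{≥0} → ℝ_{≥0}` restricted to `ℚ_{≥0}` is `q ↦ f(1) · q`. [folklore] -/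
private theorem addMonoidHom_nnreal_apply_nnrat (f : ℝ≥0 →+ ℝ≥0) (q : ℚ≥0) :
    f (q : ℝ≥0) = f 1 * (q : ℝ≥0) := by
  have h := addMonoidHom_nnrat_apply (f.comp (NNRat.castHom ℝ≥0 : ℚ≥0 →+* ℝ≥0).toAddMonoidHom) q
  simpa using h

/-- The cast `ℚ_{≥0} → ℝ_{≥0}` of `q.toNNRat` is `Real.toNNReal q` for `q ≥ 0`. [folklore] -/
private theorem cast_toNNRat_eq (q : ℚ) (hq : 0 ≤ q) : ((q.toNNRat : ℚ≥0) : ℝ≥0) = Real.toNNReal q := by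
  apply NNReal.eq
  rw [Real.coe_toNNReal _ (Rat.cast_nonneg.mpr hq)]
  change ((q.toNNRat : ℚ) : ℝ) = q
  rw [Rat.coe_toNNRat q hq]

/-- A nonnegative rational strictly between two elements of `ℝ_{≥0}`, cast through `ℚ_{≥0}`. [folklore] -/
private theorem exists_nnrat_btwn {a b : ℝ≥0} (h : a < b) : ∃ q : ℚ≥0, a < (q : ℝ≥0) ∧ (q : ℝ≥0) < b := by
  obtain ⟨q, hq0, haq, hqb⟩ := (NNReal.lt_iff_exists_rat_btwn a b).mp h
  exact ⟨q.toNNRat, by rwa [cast_toNNRat_eq q hq0], by rwa [cast_toNNRat_eq q hq0]⟩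

/-- An additive map `f : ℝ_{≥0} → ℝ_{≥0}` is `x ↦ f(1) · x` (monotonicity and density of `ℚ_{≥0}`).
[cite: MochizukiFrdI2008, §0 p.10] -/
theorem addMonoidHom_nnreal_apply (f : ℝ≥0 →+ ℝ≥0) (x : ℝ≥0) : f x = f 1 * x := by
  have hmono := addMonoidHom_nnreal_monotone f
  apply le_antisymm
  · -- `f x ≤ f 1 · x`: compare with rationals above `x`
    apply le_of_forall_gt_imp_ge_of_dense
    intro c hc
    by_cases h1 : f 1 = 0
    · obtain ⟨n, hn⟩ := exists_nat_ge x
      calc f x ≤ f n := hmono hn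
        _ = f 1 * ((n : ℚ≥0) : ℝ≥0) := by rw [← addMonoidHom_nnreal_apply_nnrat, NNRat.cast_natCast]
        _ ≤ c := by rw [h1, zero_mul]; exact zero_le
    · have h1' : 0 < f 1 := pos_iff_ne_zero.mpr h1
      have hx : x < c / f 1 := by rwa [lt_div_iff₀ h1', mul_comm]
      obtain ⟨q, hxq, hqc⟩ := exists_nnrat_btwn hx
      calc f x ≤ f q := hmono hxq.le
        _ = f 1 * (q : ℝ≥0) := addMonoidHom_nnreal_apply_nnrat f q
        _ ≤ f 1 * (c / f 1) := by gcongr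
        _ = c := mul_div_cancel₀ c h1
  · -- `f 1 · x ≤ f x`: compare with rationals below `x`
    apply le_of_forall_lt_imp_le_of_dense
    intro c hc
    have h1 : f 1 ≠ 0 := by
      rintro h
      rw [h, zero_mul] at hc
      exact not_lt_zero hc
    have h1' : 0 < f 1 := pos_iff_ne_zero.mpr h1
    have hx : c / f 1 < x := by rwa [div_lt_iff₀ h1', mul_comm]
    obtain ⟨q, hcq, hqx⟩ := exists_nnrat_btwn hx
    calc c = f 1 * (c / f 1) := (mul_div_cancel₀ c h1).symm
      _ ≤ f 1 * (q : ℝ≥0) := by gcongr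
      _ = f q := (addMonoidHom_nnreal_apply_nnrat f q).symm
      _ ≤ f x := hmono hqx.le

/-- `Hom(ℝ_{≥0}, ℝ_{≥0}) ≅ ℝ_{≥0}` via `f ↦ f(1)`. [cite: MochizukiFrdI2008, §0 p.10] -/
def nnrealAddHomEquiv : (ℝ≥0 →+ ℝ≥0) ≃+ ℝ≥0 where
  toFun f := f 1
  invFun c := AddMonoidHom.mulLeft c
  left_inv f := AddMonoidHom.ext fun x => (addMonoidHom_nnreal_apply f x).symm
  right_inv c := mul_one c
  map_add' _ _ := rfl

/-- `Hom(ℤ_{≥0}, ℝ_{≥0}) ≅ ℝ_{≥0}` via `f ↦ f(1)` (`ℤ_{≥0}` is `ℕ`). [cite: MochizukiFrdI2008, §0 p.10] -/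
def natAddHomEquiv : (ℕ →+ ℝ≥0) ≃+ ℝ≥0 := (multiplesAddHom ℝ≥0).symm

end AdditiveMaps

/-! ### The dual `M^∨ = Hom(M, ℝ_{≥0})` and `M ⊗ ℝ_{≥0} := (M^∨)^∨` -/

section Realification

variable (M : Type u) [CommMonoid M]

/-- `M^∨ := Hom(M, ℝ_{≥0})`, monoid homomorphisms into (the multiplicative copy of) the additive
monoid `ℝ_{≥0}`; a commutative monoid under pointwise operations. [cite: MochizukiFrdI2008, §0 p.10] -/
abbrev RDual : Type u := M →* Multiplicative ℝ≥0

/-- `M ⊗ ℝ_{≥0}`, "the `ℝ`-monoprime monoid obtained by completing `M`" (FrdI §0 p. 10), rendered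
as the double dual `(M^∨)^∨` (see the module docstring). [cite: MochizukiFrdI2008, §0 p.10] -/
def Realification : Type u := RDual (RDual M)

/-- `M ⊗ ℝ_{≥0}` is a commutative monoid (pointwise). [cite: MochizukiFrdI2008, §0 p.10] -/
instance Realification.instCommMonoid : CommMonoid (Realification M) :=
  inferInstanceAs (CommMonoid (RDual (RDual M)))

/-- The natural map `M → M ⊗ ℝ_{≥0}` (evaluation: `a ↦ (f ↦ f a)`). [cite: MochizukiFrdI2008, §0 p.10] -/
def Realification.of : M →* Realification M := MonoidHom.eval

variable {M}

/-- `Realification.of M a f = f a`. [cite: MochizukiFrdI2008, §0 p.10] -/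
@[simp] theorem Realification.of_apply (a : M) (f : RDual M) :
    (show RDual M →* Multiplicative ℝ≥0 from Realification.of M a) f = f a := rfl

/-- `Hom(Multiplicative A, Multiplicative ℝ_{≥0}) ≅ Multiplicative Hom(A, ℝ_{≥0})`: the bookkeeping
between multiplicative and additive notation. [folklore] -/
private def rDualMultiplicativeEquiv (A : Type) [AddCommMonoid A] :
    RDual (Multiplicative A) ≃* Multiplicative (A →+ ℝ≥0) where
  toFun f := Multiplicative.ofAdd (AddMonoidHom.toMultiplicative.symm f)
  invFun g := AddMonoidHom.toMultiplicative (Multiplicative.toAdd g)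
  left_inv _ := rfl
  right_inv _ := rfl
  map_mul' _ _ := rfl

/-- Transport of `M^∨` along an isomorphism `M ≅ Multiplicative A` followed by an identification
`Hom(A, ℝ_{≥0}) ≅ ℝ_{≥0}`. [folklore] -/
private def rDualEquivOfEquiv {A : Type} [AddCommMonoid A] (e : M ≃* Multiplicative A)
    (h : (A →+ ℝ≥0) ≃+ ℝ≥0) : RDual M ≃* Multiplicative ℝ≥0 :=
  (e.monoidHomCongrLeft.trans (rDualMultiplicativeEquiv A)).trans (AddEquiv.toMultiplicative h)

/-- If `M` is `ℚ`-monoprime then `M^∨ ≅ ℝ_{≥0}`: an additive map `ℚ_{≥0} → ℝ_{≥0}` is `q ↦ c · q`.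
[cite: MochizukiFrdI2008, §0 p.10] -/
theorem isRMonoprime_rDual_of_isQMonoprime (h : IsQMonoprime M) : IsRMonoprime (RDual M) := by
  obtain ⟨⟨e⟩⟩ := h
  exact ⟨⟨rDualEquivOfEquiv e nnratAddHomEquiv⟩⟩

/-- If `M` is `ℝ`-monoprime then `M^∨ ≅ ℝ_{≥0}`: an additive map `ℝ_{≥0} → ℝ_{≥0}` is `x ↦ c · x`.
[cite: MochizukiFrdI2008, §0 p.10] -/
theorem isRMonoprime_rDual_of_isRMonoprime (h : IsRMonoprime M) : IsRMonoprime (RDual M) := by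
  obtain ⟨⟨e⟩⟩ := h
  exact ⟨⟨rDualEquivOfEquiv e nnrealAddHomEquiv⟩⟩

/-- If `M` is `ℤ`-monoprime then `M^∨ ≅ ℝ_{≥0}`. [cite: MochizukiFrdI2008, §0 p.10] -/
theorem isRMonoprime_rDual_of_isZMonoprime (h : IsZMonoprime M) : IsRMonoprime (RDual M) := by
  obtain ⟨⟨e⟩⟩ := h
  exact ⟨⟨rDualEquivOfEquiv e natAddHomEquiv⟩⟩

/-- If `M` is monoprime then `M^∨ ≅ ℝ_{≥0}`. [cite: MochizukiFrdI2008, §0 p.10] -/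
theorem isRMonoprime_rDual (h : IsMonoprime M) : IsRMonoprime (RDual M) := by
  cases h with
  | ofZ h => exact isRMonoprime_rDual_of_isZMonoprime h
  | ofQ h => exact isRMonoprime_rDual_of_isQMonoprime h
  | ofR h => exact isRMonoprime_rDual_of_isRMonoprime h

/-- **`M ⊗ ℝ_{≥0}` is `ℝ`-monoprime** when `M` is `ℚ`-monoprime — the property printed on p. 10 —
and more generally when `M` is monoprime. [cite: MochizukiFrdI2008, §0 p.10] -/
theorem isRMonoprime_realification (h : IsMonoprime M) : IsRMonoprime (Realification M) :=
  isRMonoprime_rDual (IsMonoprime.ofR (isRMonoprime_rDual h))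

/-- The special case stated in the text: `M` `ℚ`-monoprime ⇒ `M ⊗ ℝ_{≥0}` `ℝ`-monoprime.
[cite: MochizukiFrdI2008, §0 p.10] -/
theorem isRMonoprime_realification_of_isQMonoprime (h : IsQMonoprime M) :
    IsRMonoprime (Realification M) :=
  isRMonoprime_realification (IsMonoprime.ofQ h)

/-- For a monoprime `M` some element of `M^∨` is injective (the composite of `M ≅ Λ_{≥0}` with
`Λ_{≥0} ⊆ ℝ_{≥0}`). [folklore] -/
private theorem exists_injective_rDual (h : IsMonoprime M) : ∃ f : RDual M, Injective f := by
  cases h with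
  | ofZ h =>
    obtain ⟨⟨e⟩⟩ := h
    have hc : Injective (AddMonoidHom.toMultiplicative (Nat.castAddMonoidHom ℝ≥0)) :=
      fun a b hab => Multiplicative.toAdd.injective (Nat.cast_injective
        (Multiplicative.ofAdd.injective hab))
    exact ⟨(AddMonoidHom.toMultiplicative (Nat.castAddMonoidHom ℝ≥0)).comp e.toMonoidHom,
      hc.comp e.injective⟩
  | ofQ h =>
    obtain ⟨⟨e⟩⟩ := h
    have hc : Injective (AddMonoidHom.toMultiplicative
        (NNRat.castHom ℝ≥0 : ℚ≥0 →+* ℝ≥0).toAddMonoidHom) :=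
      fun a b hab => Multiplicative.toAdd.injective (NNRat.cast_injective
        (Multiplicative.ofAdd.injective hab))
    exact ⟨(AddMonoidHom.toMultiplicative
      (NNRat.castHom ℝ≥0 : ℚ≥0 →+* ℝ≥0).toAddMonoidHom).comp e.toMonoidHom, hc.comp e.injective⟩
  | ofR h =>
    obtain ⟨⟨e⟩⟩ := h
    exact ⟨e.toMonoidHom, e.injective⟩

/-- For a monoprime `M` the natural map `M → M ⊗ ℝ_{≥0}` is injective (so `M` may be regarded
as a submonoid of its completion, as on p. 10 and in Def. 2.4 (i)). [cite: MochizukiFrdI2008, §0 p.10] -/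
theorem Realification.of_injective (h : IsMonoprime M) : Injective (Realification.of M) := by
  obtain ⟨f, hf⟩ := exists_injective_rDual h
  intro a b hab
  apply hf
  exact congrArg (fun φ : Realification M => (show RDual (RDual M) from φ) f) hab

/-- The natural map `M → M ⊗ ℝ_{≥0}` is order-preserving for the divisibility orders `≤` of §0
(any monoid homomorphism is). [cite: MochizukiFrdI2008, §0 p.10] -/
theorem Realification.of_dvd {a b : M} (h : a ∣ b) : Realification.of M a ∣ Realification.of M b :=
  map_dvd _ h

/-- Functoriality of `M ⊗ ℝ_{≥0}`: a homomorphism `M → N` induces `M ⊗ ℝ_{≥0} → N ⊗ ℝ_{≥0}`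
(double transpose). [cite: MochizukiFrdI2008, §0 p.10] -/
def Realification.map {N : Type u} [CommMonoid N] (φ : M →* N) :
    Realification M →* Realification N :=
  MonoidHom.compHom' (MonoidHom.compHom' φ)

/-- `Realification.map φ` is compatible with the natural maps: `map φ (of a) = of (φ a)`.
[cite: MochizukiFrdI2008, §0 p.10] -/
theorem Realification.map_of {N : Type u} [CommMonoid N] (φ : M →* N) (a : M) :
    Realification.map φ (Realification.of M a) = Realification.of N (φ a) := rfl

end Realification

end Literature.AlgebraicGeometry.Frobenioids
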